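import Summits.KontsevichZagierPeriods.Zeta5Search.RVPeriodicShift
import HarnessLib

/-!
# ζ(5) search — RHIN–VIOLA SHIFT LAW for the Casoratian class bound `LB = VB + rowMin` below `θ = 1` (fam-rv g17, PROOFS)

HONEST FRAMING: systematic search; no irrationality claim unless certified.  Pure combinatorics of the explicit integer vector
`b(n) = n·(85; 35,32,30,27,25,22,20)` and a prime `p ≤ n`; nothing about `ζ(5)`; every exponent this could ever feed is `< 1`.

OUR work (Summit side; family-designer seat `fam-rv`, generation 17).  Below `θ = p/n = 1` every residue class of the ray has `≥ 40` poles
(`classPoleCount_ge`), so the class bound of `ClusterValuationPairs` collapses to `LB(b(n),p) = 2·min_x E_x + 3` (`casLB_bC1_eq`) and the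
class-exponent shift law gives `LB(b(n+p),p) = LB(b(n),p) − 256` (`casLB_shift`): the letters `M` of the kernel ledger are PERIODIC in `{n/p}`
after the renormalisation `B ↦ B + 256·⌊n/p⌋`, for every shift at once.
-/

namespace Summit.KontsevichZagierPeriods.Zeta5Search.RVPeriodic

open Finset
open Summit.KontsevichZagierPeriods.Zeta5Search.RayC1
open Summit.KontsevichZagierPeriods.Zeta5Search.ClusterValuation
open Summit.KontsevichZagierPeriods.Zeta5Search.WedgeDictionary (dOf)

/-! ## §5 The Casoratian class bound below `θ = 1` -/

section CasLB

variable {p : ℕ} [hp : Fact p.Prime]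

/-- Below `θ = 1` there are no single-pole classes, so `ν_x = E_x`. -/
theorem classNu_bC1 (n x : ℕ) (hpn : p ≤ n) : classNu (bC1 n) p x = classExp (bC1 n) p x := by
  unfold classNu
  rw [if_neg]
  intro h
  have := classPoleCount_ge n x hpn
  omega

/-- `VB(b(n), p)` is the minimum of the class exponents over all residues. -/
theorem vbMin_bC1 (n : ℕ) (hpn : p ≤ n) : vbMin (bC1 n) p = ((List.range p).map (classExp (bC1 n) p)).min? := by
  unfold vbMin
  have hf : ((List.range p).filter fun x => 1 ≤ classPoleCount (bC1 n) p x) = List.range p :=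
    List.filter_eq_self.2 fun x _ => by
      have := classPoleCount_ge n x hpn
      simp only [decide_eq_true_eq]
      omega
  rw [hf, List.map_congr_left fun x _ => classNu_bC1 n x hpn]

-- `dOf_bC1 : dOf (bC1 n) = 64 * n` is the tree's `RayC1.dOf_bC1` (Certificates/RayC1KernelBigPrime), reused by name
-- (filer's dedup fix, lead/lit g16: the staged local copy restated it verbatim — gate `dedup.landed`).

omit hp in
/-- `filterMap f = map g` when `f = some ∘ g` on the list. -/
theorem filterMap_eq_map_of {α β : Type*} {f : α → Option β} {g : α → β} {l : List α}
    (h : ∀ a ∈ l, f a = some (g a)) : l.filterMap f = l.map g := by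
  induction l with
  | nil => rfl
  | cons a l ih =>
    rw [List.filterMap_cons_some (h a (by simp)), List.map_cons, ih fun b hb => h b (by simp [hb])]

/-- The row term below `θ = 1`: every class is a multipole class and `p ≤ d = 64n`, so `rowMin = min_x (3 + E_x)`. -/
theorem rowMin_bC1 (n : ℕ) (hpn : p ≤ n) :
    rowMin (bC1 n) p = ((List.range p).map fun x => 3 + classExp (bC1 n) p x).min? := by
  unfold rowMin
  have hd : ¬ dOf (bC1 n) < (p : ℤ) := by rw [dOf_bC1]; omega
  rw [if_neg hd, List.append_nil]
  rw [filterMap_eq_map_of]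
  intro x _
  have := classPoleCount_ge n x hpn
  rw [if_neg (by omega), if_pos (by omega)]

omit hp in
/-- Translating every entry by `c` translates the running minimum by `c`. -/
theorem foldl_min_add (l : List ℤ) (a c : ℤ) : (l.map (· + c)).foldl min (a + c) = l.foldl min a + c := by
  induction l generalizing a with
  | nil => rfl
  | cons b l ih => simp only [List.map_cons, List.foldl_cons]; rw [min_add_add_right, ih]

omit hp in
/-- Shifting every entry shifts the minimum. -/
theorem min?_map_add (l : List ℤ) (c : ℤ) : (l.map (· + c)).min? = l.min?.map (· + c) := by
  cases l with
  | nil => rfl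
  | cons a l =>
    show some (List.foldl min (a + c) (l.map (· + c))) = some (List.foldl min a l + c)
    rw [foldl_min_add]

omit hp in
/-- The minimum over a nonempty range exists. -/
theorem min?_map_range_isSome (hp0 : 0 < p) (f : ℕ → ℤ) : ∃ v, ((List.range p).map f).min? = some v := by
  cases hl : (List.range p).map f with
  | nil =>
    rw [List.map_eq_nil_iff, List.range_eq_nil] at hl
    omega
  | cons a t => exact ⟨_, rfl⟩

omit hp in
/-- `casLB` from the two certified minima. -/
theorem casLB_of_some {b : ℕ → ℤ} {q : ℕ} {v r : ℤ} (hv : vbMin b q = some v) (hr : rowMin b q = some r) :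
    casLB b q = v + r := by
  unfold casLB
  rw [hv, hr]

/-- **SHIFT LAW FOR THE CASORATIAN CLASS BOUND** (`CasLBShiftLaw` of `RVPeriodicWindows`): below `θ = 1`,
`LB(b(n+p), p) = LB(b(n), p) − 256`. -/
theorem casLB_shift (hp2 : p ≠ 2) (n : ℕ) (hpn : p ≤ n) : casLB (bC1 (n + p)) p = casLB (bC1 n) p - 256 := by
  have hpn' : p ≤ n + p := by omega
  have hp0 : 0 < p := hp.out.pos
  obtain ⟨v, hv⟩ := min?_map_range_isSome hp0 (classExp (bC1 n) p)
  obtain ⟨r, hr⟩ := min?_map_range_isSome hp0 (fun x => 3 + classExp (bC1 n) p x)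
  have hE : (List.range p).map (classExp (bC1 (n + p)) p) = ((List.range p).map (classExp (bC1 n) p)).map (· + (-128)) := by
    rw [List.map_map]
    exact List.map_congr_left fun x _ => by simp only [Function.comp, classExp_shift hp2 n x]; ring
  have hR : (List.range p).map (fun x => 3 + classExp (bC1 (n + p)) p x) =
      ((List.range p).map fun x => 3 + classExp (bC1 n) p x).map (· + (-128)) := by
    rw [List.map_map]
    exact List.map_congr_left fun x _ => by simp only [Function.comp, classExp_shift hp2 n x]; ring
  have hv' : vbMin (bC1 (n + p)) p = some (v + (-128)) := by
    rw [vbMin_bC1 (n + p) hpn', hE, min?_map_add, hv]; rfl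
  have hr' : rowMin (bC1 (n + p)) p = some (r + (-128)) := by
    rw [rowMin_bC1 (n + p) hpn', hR, min?_map_add, hr]; rfl
  rw [casLB_of_some hv' hr', casLB_of_some ((vbMin_bC1 n hpn).trans hv) ((rowMin_bC1 n hpn).trans hr)]
  ring

/-- The explicit value: `LB(b(n),p) = 2·min_x E_x + 3` below `θ = 1`. -/
theorem casLB_bC1_eq (n : ℕ) (hpn : p ≤ n) {v : ℤ} (hv : ((List.range p).map (classExp (bC1 n) p)).min? = some v) :
    casLB (bC1 n) p = 2 * v + 3 := by
  have hR : ((List.range p).map fun x => 3 + classExp (bC1 n) p x) = ((List.range p).map (classExp (bC1 n) p)).map (· + 3) := by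
    rw [List.map_map]
    exact List.map_congr_left fun x _ => by simp only [Function.comp]; ring
  have hr : rowMin (bC1 n) p = some (v + 3) := by
    rw [rowMin_bC1 n hpn, hR, min?_map_add, hv]; rfl
  rw [casLB_of_some ((vbMin_bC1 n hpn).trans hv) hr]
  ring

end CasLB

end Summit.KontsevichZagierPeriods.Zeta5Search.RVPeriodic
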